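import Summits.QuantumFields.BalabanUV.Beta.GAN24.DerivativeRateTransferJensenMassFreeEnd
import Summits.QuantumFields.BalabanUV.Beta.GAN24.DerivativeRateTransferJensenLattice

/-!
# `BalabanUV.Beta.GAN24.DerivativeRateTransferJensenMassFreeLattice` — binder row G-an2-4 ∕ (CONV-C), route R6 «VALUES, NOT DERIVATIVES», PART 54:
# THE BLOCK-LATTICE INSTANCE OF THE MASS-FREE COVARIANT JENSEN INEQUALITY — PART 53's `δ = 0` END for the polar pair with its combinatorial
# hypotheses (block weights summing to ONE, pairings, straight chains with carry, q-weighted multiplicity `L·L^{−d}`) DISCHARGED on PART 24's geometry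
# «coarse torus `(ℤ∕M)^d`, blocks of side `L`», for ANY orthogonal transporter data `R, R′, W` carrying the polar letter `hsym` and any block Poincaré
# datum `Φ ∕ ϖ ∕ ϖ′` (unit b2b-balaban-gan24-p3, gen 43; v1)

NOT IN PRINT; OUR PROOF (for the ROUTE; [folklore] finite combinatorics of the block lattice — PART 24's §1–§2 lemmas and PART 53's END BY NAME).  HONEST
FRAMING (cell contract, verbatim): «discharging `BetaPertH` makes Bałaban's UV stability UNCONDITIONAL — a real constructive-QFT result; it is NOT the
continuum limit and NOT the Clay problem.»  HONEST DEPENDENCY (verbatim): «continuum YM on T⁴ ⇐ BetaPertH ∧ nine spine estimates (0/9 proved); BetaPertH ⇐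
(D1) ∧ (D4) ∧ CAP+tail; G-an2-4 gates asym, D1 and NE2/3/4.»

WHY THIS FILE.  PART 50 (`DerivativeRateTransferJensenMeanZeroLattice.covJensen_meanZero_lattice`) put PART 47's consistent-pair END on the block
lattice; THIS FILE does the same for PART 53's MASS-FREE END `covJensen_polar_massFree` — the second half of the pricing desk's ARMED condition «a TREE ✓
of a mass-free END (δ = 0 in the statement) WITH its lattice instance typed» (PRICING-GAN24 v3.50, Q-56-1 ∕ Q-56-3).  Coarse sites `y : Fin d → ZMod M`,
fine sites `(block, position) : (Fin d → ZMod M) × (Fin d → Fin L)`, block weights `[x.1 = y]·(L^d)⁻¹` (summing to `1` EXACTLY — PART 24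
`sum_blockWeight`; the mass-free END needs the mean to be a mean), coarse bonds `(y, μ)` from `y` to `y + e_μ`, the pairing = translation by one block,
the straight chains with carry of PART 24, q-weighted multiplicity EXACTLY `L·(L^d)⁻¹`.  What stays DATA: the orthogonal transporters `R, R′, W`, the
chain transports `T`, the root-frame defects `N` with their pointwise `κ` (`κ² < 4`) and the POLAR letter «`Σ_x q(y,x)·N((y,μ),x)` symmetric», and the
block Poincaré datum `Φ` with its budgets over bond TARGETS (`ϖ`) and bond SOURCES (`ϖ′`) (PART 55 discharges them for rooted tree transports).  THEN
(§2 **`covJensen_polar_massFree_lattice`**) for all `t, r > 0`: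
  `⟨Qu, H_cQu⟩ ≤ (1 + t + (1+t⁻¹)(1+r)ϖκ² + (1+t⁻¹)(1+r⁻¹)·(3κ²∕(4 − κ²))·(1 + ϖ + ϖ′))·⟨u, H_f u⟩`      — NO `⟨Qu,Qu⟩` term, NO in-degree letter.

WHAT THIS FILE PROVES (0 sorry, 0 `def`, nothing cited): §1 `card_outdegree_le` (the out-degree letter `d″ = d` for PART 55's `ϖ′` on this encoding);
§2 **`covJensen_polar_massFree_lattice`**.
WHAT IT DOES NOT DO: choose Bałaban's contours for `W` ∕ his polar `Ū` for `R′` (DATA; the symmetry letter `hsym` is what PART 51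
`wsum_defect_symm_of_polar` extracts from «`R′` = polar factor of the mean open transport»), bound `κ`, instantiate PART 55's tree data on this
encoding (taxi contours), vector fields.  SUPPLIER work on route R6 (rank 2, REDUCTION, no seat); no consumer of record; NEVER «G-an2-4 closed»; NOT
(CONV-C), NOT D1, NOT `BetaPertH`, NOT continuum, NOT Clay.  Records: `HOME/b2b-balaban-gan24-p3/WOODBURY-FIBRE.md` v14.3. -/

noncomputable section

open Matrix Finset Function

namespace Summit.QuantumFields.BalabanUV.Beta.GAN24.DerivativeRateTransferJensenMassFreeLattice

open Summit.QuantumFields.BalabanUV.Beta.GAN24.DerivativeRateTransferJensen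
open Summit.QuantumFields.BalabanUV.Beta.GAN24.DerivativeRateTransferJensenLattice
open Summit.QuantumFields.BalabanUV.Beta.GAN24.DerivativeRateTransferJensenMassFreeEnd

variable {d L M : ℕ}

/-! ## §1 The out-degree of the coarse bond graph -/

/-- **OUT-DEGREE `≤ d`**: the coarse bonds `(y′, μ)` with `y′ = y` are the `d` bonds `(y, μ)` — the letter `d″` of PART 55's source budget `ϖ′` on this
encoding (PART 50 `card_indegree_le` is the in-degree `d′`). [folklore] -/
theorem card_outdegree_le [NeZero M] (y : Fin d → ZMod M) :
    (((Finset.univ.filter fun e' : (Fin d → ZMod M) × Fin d => e'.1 = y).card : ℕ) : ℝ) ≤ d := by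
  have hsub : (Finset.univ.filter fun e' : (Fin d → ZMod M) × Fin d => e'.1 = y) ⊆
      Finset.univ.image (fun μ : Fin d => ((y, μ) : (Fin d → ZMod M) × Fin d)) := by
    intro e' he'
    rw [Finset.mem_filter] at he'
    rw [Finset.mem_image]
    exact ⟨e'.2, Finset.mem_univ _, by rw [← he'.2]⟩
  have h1 := Finset.card_le_card hsub
  have h2 := Finset.card_image_le (s := (Finset.univ : Finset (Fin d))) (f := fun μ : Fin d => ((y, μ) : (Fin d → ZMod M) × Fin d))
  rw [Finset.card_univ, Fintype.card_fin] at h2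
  exact_mod_cast h1.trans h2

/-! ## §2 PART 53's mass-free END on the block lattice -/

/-- **`covJensen_polar_massFree_lattice` — THE MASS-FREE COVARIANT JENSEN INEQUALITY ON THE BLOCK LATTICE** [our proof; PART 53
`covJensen_polar_massFree` + PART 24 §1–§2].  Data: dimension `d`, block side `L > 0`, coarse torus `(ZMod M)^d`, `M ≠ 0`; colour space `o`; orthogonal
fine bond transporters `R (x, μ)`, coarse bond transporters `R′ (y, μ)` (ORTHOGONAL), block transporters `W y x`; the averaging
`(Qu)(y) = Σ_x [x.1 = y](L^d)⁻¹·W y x·u x`; a coarse form `H_c ≤ w_c·Σ_{(y,μ)} |R′_{(y,μ)} v(y + e_μ) − v(y)|²`, a fine form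
`H_f ≥ w_f·Σ_{(x,μ)} |R_{(x,μ)} u(x⁺) − u(x)|²` (`x⁺` = next site in direction `μ`, with carry), `0 ≤ w_c`, `w_c·L·(L·(L^d)⁻¹) ≤ w_f`; chain transports
`T`; root-frame defects `N (y,μ) x = 1 − W y x·T_L·W(y + e_μ)(x + e_μ-block)ᵀ·R′ᵀ` with `|Nw|² ≤ κ²|w|²`, `κ² < 4`, and the POLAR letter
`(Σ_x q(y,x)•N (y,μ) x)ᵀ = Σ_x q(y,x)•N (y,μ) x`; a block Poincaré datum `Φ` with `w_c·Σ_{(y,μ)}Φ(y + e_μ) ≤ ϖ⟨u,H_fu⟩` and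
`w_c·Σ_{(y,μ)}Φ(y) ≤ ϖ′⟨u,H_fu⟩`.  Then for all `t, r > 0`:
`⟨Qu, H_cQu⟩ ≤ (1 + t + (1+t⁻¹)(1+r)ϖκ² + (1+t⁻¹)(1+r⁻¹)·(3κ²∕(4 − κ²))·(1 + ϖ + ϖ′))·⟨u, H_f u⟩`. -/
theorem covJensen_polar_massFree_lattice {o : Type*} [Fintype o] [DecidableEq o] [NeZero M] (hL : 0 < L)
    {R : ((Fin d → ZMod M) × (Fin d → Fin L)) × Fin d → Matrix o o ℝ} (hR : ∀ e, (R e)ᵀ * R e = 1)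
    {R' : (Fin d → ZMod M) × Fin d → Matrix o o ℝ} (hR' : ∀ e', (R' e')ᵀ * R' e' = 1)
    {W : (Fin d → ZMod M) → (Fin d → ZMod M) × (Fin d → Fin L) → Matrix o o ℝ} (hW : ∀ y x, (W y x)ᵀ * W y x = 1)
    {Q : Matrix ((Fin d → ZMod M) × o) (((Fin d → ZMod M) × (Fin d → Fin L)) × o) ℝ}
    (hQ : ∀ (u : ((Fin d → ZMod M) × (Fin d → Fin L)) × o → ℝ) (y : Fin d → ZMod M),
      (fun a => (Q *ᵥ u) (y, a)) = ∑ x, (if x.1 = y then ((L : ℝ) ^ d)⁻¹ else 0) • (W y x *ᵥ fun b => u (x, b)))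
    {Hf : Matrix (((Fin d → ZMod M) × (Fin d → Fin L)) × o) (((Fin d → ZMod M) × (Fin d → Fin L)) × o) ℝ}
    {Hc : Matrix ((Fin d → ZMod M) × o) ((Fin d → ZMod M) × o) ℝ} {wf wc : ℝ} (hwc : 0 ≤ wc)
    (hHc : ∀ v : (Fin d → ZMod M) × o → ℝ, v ⬝ᵥ (Hc *ᵥ v) ≤
      wc * ∑ e' : (Fin d → ZMod M) × Fin d, ((R' e' *ᵥ fun a => v (e'.1 + Pi.single e'.2 1, a)) - fun a => v (e'.1, a)) ⬝ᵥ
        ((R' e' *ᵥ fun a => v (e'.1 + Pi.single e'.2 1, a)) - fun a => v (e'.1, a)))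
    (hHf : ∀ u : ((Fin d → ZMod M) × (Fin d → Fin L)) × o → ℝ,
      wf * ∑ e : ((Fin d → ZMod M) × (Fin d → Fin L)) × Fin d,
        ((R e *ᵥ fun b => u ((e.1.1 + ((((e.1.2 e.2 : ℕ) + 1) / L) • (Pi.single e.2 (1 : ZMod M))),
            update e.1.2 e.2 ⟨((e.1.2 e.2 : ℕ) + 1) % L, Nat.mod_lt _ hL⟩), b)) - fun b => u (e.1, b)) ⬝ᵥ
          ((R e *ᵥ fun b => u ((e.1.1 + ((((e.1.2 e.2 : ℕ) + 1) / L) • (Pi.single e.2 (1 : ZMod M))),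
            update e.1.2 e.2 ⟨((e.1.2 e.2 : ℕ) + 1) % L, Nat.mod_lt _ hL⟩), b)) - fun b => u (e.1, b)) ≤ u ⬝ᵥ (Hf *ᵥ u))
    {T : (Fin d → ZMod M) × Fin d → (Fin d → ZMod M) × (Fin d → Fin L) → ℕ → Matrix o o ℝ} (hT0 : ∀ e' x, T e' x 0 = 1)
    (hT : ∀ e' x i, i < L → T e' x (i + 1) = T e' x i *
      R (((x.1 + (((x.2 e'.2 : ℕ) + i) / L) • (Pi.single e'.2 (1 : ZMod M)),
            update x.2 e'.2 ⟨((x.2 e'.2 : ℕ) + i) % L, Nat.mod_lt _ hL⟩) : (Fin d → ZMod M) × (Fin d → Fin L)), e'.2))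
    (hw : wc * L * (L * ((L : ℝ) ^ d)⁻¹) ≤ wf)
    {N : (Fin d → ZMod M) × Fin d → (Fin d → ZMod M) × (Fin d → Fin L) → Matrix o o ℝ}
    (hNdef : ∀ e' x, N e' x = 1 - W e'.1 x * T e' x L * (W (e'.1 + Pi.single e'.2 1) (x.1 + Pi.single e'.2 1, x.2))ᵀ * (R' e')ᵀ)
    {κ : ℝ} (hN : ∀ e' x (w : o → ℝ), (N e' x *ᵥ w) ⬝ᵥ (N e' x *ᵥ w) ≤ κ ^ 2 * (w ⬝ᵥ w))
    (hsym : ∀ e', (∑ x, (if x.1 = e'.1 then ((L : ℝ) ^ d)⁻¹ else 0) • N e' x)ᵀ = ∑ x, (if x.1 = e'.1 then ((L : ℝ) ^ d)⁻¹ else 0) • N e' x)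
    (hκ : κ ^ 2 < 4)
    (u : ((Fin d → ZMod M) × (Fin d → Fin L)) × o → ℝ) {Φ : (Fin d → ZMod M) → ℝ} {ϖ ϖ' : ℝ}
    (hP : ∀ y, ∑ x, (if x.1 = y then ((L : ℝ) ^ d)⁻¹ else 0) * (((W y x *ᵥ fun b => u (x, b)) - fun a => (Q *ᵥ u) (y, a)) ⬝ᵥ
        ((W y x *ᵥ fun b => u (x, b)) - fun a => (Q *ᵥ u) (y, a))) ≤ Φ y)
    (hΦ : wc * ∑ e' : (Fin d → ZMod M) × Fin d, Φ (e'.1 + Pi.single e'.2 1) ≤ ϖ * (u ⬝ᵥ (Hf *ᵥ u)))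
    (hΦ' : wc * ∑ e' : (Fin d → ZMod M) × Fin d, Φ e'.1 ≤ ϖ' * (u ⬝ᵥ (Hf *ᵥ u)))
    {t r : ℝ} (ht : 0 < t) (hr : 0 < r) :
    (Q *ᵥ u) ⬝ᵥ (Hc *ᵥ (Q *ᵥ u)) ≤
      (1 + t + (1 + t⁻¹) * (1 + r) * ϖ * κ ^ 2 + (1 + t⁻¹) * (1 + r⁻¹) * (3 * κ ^ 2 / (4 - κ ^ 2)) * (1 + ϖ + ϖ')) *
        (u ⬝ᵥ (Hf *ᵥ u)) := by
  haveI : NeZero L := ⟨hL.ne'⟩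
  refine covJensen_polar_massFree (o := o) (μ := Fin d → ZMod M) (ν := (Fin d → ZMod M) × (Fin d → Fin L))
    (β := ((Fin d → ZMod M) × (Fin d → Fin L)) × Fin d) (β' := (Fin d → ZMod M) × Fin d)
    (q := fun (y : Fin d → ZMod M) (x : (Fin d → ZMod M) × (Fin d → Fin L)) => if x.1 = y then ((L : ℝ) ^ d)⁻¹ else 0)
    (W := W) (Q := Q) (src := fun e : ((Fin d → ZMod M) × (Fin d → Fin L)) × Fin d => e.1)
    (tgt := fun e : ((Fin d → ZMod M) × (Fin d → Fin L)) × Fin d =>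
      ((e.1.1 + ((((e.1.2 e.2 : ℕ) + 1) / L) • (Pi.single e.2 (1 : ZMod M))),
        update e.1.2 e.2 ⟨((e.1.2 e.2 : ℕ) + 1) % L, Nat.mod_lt _ hL⟩) : (Fin d → ZMod M) × (Fin d → Fin L)))
    (R := R) (src' := fun e' : (Fin d → ZMod M) × Fin d => e'.1)
    (tgt' := fun e' : (Fin d → ZMod M) × Fin d => e'.1 + Pi.single e'.2 1) (R' := R') (Hf := Hf) (Hc := Hc) (wf := wf) (wc := wc)
    (σ := fun e' : (Fin d → ZMod M) × Fin d => (Equiv.addRight (Pi.single e'.2 (1 : ZMod M))).prodCongr (Equiv.refl (Fin d → Fin L)))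
    (ℓ := L)
    (xs := fun (e' : (Fin d → ZMod M) × Fin d) (x : (Fin d → ZMod M) × (Fin d → Fin L)) (i : ℕ) =>
      ((x.1 + (((x.2 e'.2 : ℕ) + i) / L) • (Pi.single e'.2 (1 : ZMod M)),
        update x.2 e'.2 ⟨((x.2 e'.2 : ℕ) + i) % L, Nat.mod_lt _ hL⟩) : (Fin d → ZMod M) × (Fin d → Fin L)))
    (γ := fun (e' : (Fin d → ZMod M) × Fin d) (x : (Fin d → ZMod M) × (Fin d → Fin L)) (i : ℕ) =>
      (((x.1 + (((x.2 e'.2 : ℕ) + i) / L) • (Pi.single e'.2 (1 : ZMod M)),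
        update x.2 e'.2 ⟨((x.2 e'.2 : ℕ) + i) % L, Nat.mod_lt _ hL⟩) : (Fin d → ZMod M) × (Fin d → Fin L)), e'.2))
    (T := T) (m := L * ((L : ℝ) ^ d)⁻¹) (N := N) (Φ := fun _ => Φ) (ϖ := ϖ) (ϖ' := ϖ') (κ := κ) (t := t) (r := r)
    ?_ ?_ hW hR hR' hQ hwc hHc ?hf ?_ ?_ ?_ ?_ ?_ hT0 hT ?_ hw hNdef hN hsym hκ u hP hΦ hΦ' ht hr
  case hf =>
    intro u'
    convert hHf u' using 6
  · exact fun y x => blockWeight_nonneg y x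
  · exact fun y => sum_blockWeight y
  · exact fun e' x => blockWeight_pair e'.1 (Pi.single e'.2 1) x
  · exact fun e' x => chain_zero hL e'.2 x
  · intro e' x
    show _ = ((Equiv.addRight (Pi.single e'.2 (1 : ZMod M))).prodCongr (Equiv.refl (Fin d → Fin L))) x
    rw [chain_end hL e'.2 x]
    rfl
  · exact fun e' x i _ => rfl
  · exact fun e' x i _ => chain_step hL e'.2 x i
  · exact fun e => (sum_chainWeight hL e).le

end Summit.QuantumFields.BalabanUV.Beta.GAN24.DerivativeRateTransferJensenMassFreeLattice

end
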